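import Mathlib
import Summits.ValiantsHypothesis.ValiantsHypothesis.Theorems.BarrierLeverPartitionMinorsHitByVPHiddenStatesBallTop
import Summits.ValiantsHypothesis.ValiantsHypothesis.Theorems.BarrierLeverPartitionMinorsHitByVPHiddenStatesCoSizeStructure
import Summits.ValiantsHypothesis.ValiantsHypothesis.Theorems.BarrierLeverPartitionMinorsHitByVPHiddenStatesSigmaTable
import Summits.ValiantsHypothesis.ValiantsHypothesis.Theorems.BarrierLeverPartitionMinorsHitByVPHiddenStatesCoreLiftDiagonal

/-!
# Route BarrierLever — item `PartitionMinorsHitByVP` (stmt-ValiantsHypothesis-19717), line `hidden-states`: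
# BALL-DIAGONAL VII — THE BALL-DIAGONAL THEOREM, ALL DIAGONAL CELLS, AND THE LINEAR TOP WINDOW OF THE LOWER NODE

Helper file (`--supports stmt-ValiantsHypothesis-19717`; cell valiant-natproofs, rung V4, 𝒟-side door (c), registered line
`Cruxes/PartitionMinorsHitByVP/Lines/hidden_states.lean` v8; prover seat val-np-p6 gen 13). Definition-free; closes NO item.

THE THEOREM (paper: HOME/val-np-p6/g12/PROOF-balldiagonal-p6g12.md; exhaustive numerics `h ≤ 9`, kit j307595; now in the kernel).
`ball_good`: for every `h` and every injective LOWER row family `u` of `2^h − h − 1` subsets of `Fin h` (a down-set of co-size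
`h + 1`), ONE piece whose columns run through all state sets `J` with `|J| ≤ h − 2` (the ball `B_{h−2}` on `h` states) is good: the
σ-TABLE (`Tilt.exists_sigmaTable`, p630805: `t_q = e_q` off the core, `t_c = e_c − 1_{F c}` on the core, `F` a bijection core →
missing complex, `BallDiag.coSize_structure_iff`) makes the block-additive matrix nonsingular, because every row-kernel vector
vanishes (`BallDiag.rowKernel_zero`, p633023: block elimination over `2^C`, translated Möbius inversion, face-poset system).

CONSEQUENCES.
* `card_ball`, `ballCell` — the body of `LowerNode.Stmt.universalJoinWideLower` (p599518) at `(h, 2^h − (h+1))` for every `h ≥ 1`,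
  with the legal one-piece design (`m = 1`, `K = h`, unit weights; the non-columns are exactly the heavier state sets `|J| ≥ h − 1`).
* **`diagonalCell`** — EVERY DIAGONAL CELL `D_c = (c − 1, 2^{c−1} − c)`, `c ≥ 2` (the hypothesis of p629886
  `CoreLift.universalJoinWideLower_of_diagonal`; previously known for `c ≤ 19` only, `CoreLift.diagonal_le_nineteen`).
* **`universalJoinWideLower_linearWindow`** — THE LINEAR WINDOW: the lower node at `(h, 2^h − c)` for EVERY `h` and EVERY
  `2 ≤ c ≤ h + 1` (was `c ≤ min(h, 20)`, p628612 `TiltCells.universalJoinWideLower_top_twenty`);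
  `universalJoinWideLower_topWindow`: every `h ≥ 1` and every `c ≤ h + 1`. At `h = 19` this adds the single cell `r = 2^19 − 20`
  (open window now `517 159 ≤ r ≤ 524 267`); for large `h` the known top window grows from 21 to `h + 2` sizes.

WHAT THIS IS NOT: the top window of the lower node is now linear in `h` (co-size `≤ h + 1`); core-less down-sets (co-size `≥ h + 2`)
and the bulk are untouched, no stub of the line is closed, item 19717 stays open; nothing on crux 14610 or VP ≠ VNP.
-/

set_option linter.dupNamespace false

namespace Summit.ValiantsHypothesis.ValiantsHypothesis.Theorems.BarrierLever.HiddenStates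

open Finset

noncomputable section

namespace BallDiag

/-- **THE BALL-DIAGONAL THEOREM.** One piece `p₀` whose columns `cols` run through all state sets `J ⊆ Fin h` with `|J| + 2 ≤ h`
is good — with the σ-table — against every injective lower row family of `2^h − h − 1` subsets of `Fin h`. See the module docstring. -/
theorem ball_good (h r m : ℕ) (p₀ : Fin m) (u : Fin r → Finset (Fin h)) (hu : Function.Injective u)
    (hlow : IsLowerSet (Set.range u)) (hr : r + (h + 1) = 2 ^ h)
    (cols : Fin r → Finset (Fin h)) (hcols : ∀ J : Finset (Fin h), J.card + 2 ≤ h → ∃ k, cols k = J) :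
    ∃ tx : Fin m → Option (Fin h) → Fin h → ℂ,
      (Matrix.of fun i k : Fin r => ∏ a ∈ u i, (tx p₀ none a + ∑ q ∈ cols k, tx p₀ (some q) a)).det ≠ 0 := by
  classical
  obtain ⟨C, N, 𝔈, F, hN, h𝔈N, h𝔈2, hclosed, hF𝔈, hFinj, hFoff, hclass⟩ := coSize_structure_iff h r u hu hlow hr
  have hF : ∀ c a, a ∈ F c → a ∉ C := by
    intro c a ha
    by_cases hc : c ∈ C
    · have := h𝔈N _ (hF𝔈 c hc) ha
      rw [hN, Finset.mem_sdiff] at this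
      exact this.2
    · rw [hFoff c hc] at ha
      exact absurd ha (Finset.notMem_empty a)
  obtain ⟨tx, htx⟩ := Tilt.exists_sigmaTable h m p₀ C F hF
  refine ⟨tx, fun hdet => ?_⟩
  obtain ⟨β, hβ, hβM⟩ := Matrix.exists_vecMul_eq_zero_iff.mpr hdet
  -- the row-kernel vector as a function on subsets
  let b : Finset (Fin h) → ℂ := fun S => ∑ i ∈ Finset.univ.filter (fun i => u i = S), β i
  have hbu : ∀ i, b (u i) = β i := by
    intro i
    have : Finset.univ.filter (fun j => u j = u i) = {i} := by
      ext j
      simp only [Finset.mem_filter, Finset.mem_univ, true_and, Finset.mem_singleton]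
      exact ⟨fun hj => hu hj, fun hj => by rw [hj]⟩
    simp only [b, this, Finset.sum_singleton]
  have hboff : ∀ S, S ∉ Set.range u → b S = 0 := by
    intro S hS
    have : Finset.univ.filter (fun j => u j = S) = ∅ := by
      ext j
      simp only [Finset.mem_filter, Finset.mem_univ, true_and, Finset.notMem_empty, iff_false]
      exact fun hj => hS ⟨j, hj⟩
    simp only [b, this, Finset.sum_empty]
  have hb_univ : b Finset.univ = 0 := hboff _ ((hclass _).mpr (Or.inl rfl))
  have hb_erase : ∀ y ∈ N, b (Finset.univ.erase y) = 0 :=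
    fun y hy => hboff _ ((hclass _).mpr (Or.inr (Or.inl ⟨y, hy, rfl⟩)))
  have hb_E : ∀ E ∈ 𝔈, b (Finset.univ \ E) = 0 :=
    fun E hE => hboff _ ((hclass _).mpr (Or.inr (Or.inr ⟨E, hE, rfl⟩)))
  -- the column equations
  have hcol : ∀ J : Finset (Fin h), J.card + 2 ≤ h →
      ∑ S : Finset (Fin h), b S * ((if S ∩ C ⊆ J then 1 else 0) *
        ∏ a ∈ S \ C, ((if a ∈ J then (1 : ℂ) else 0) - (((J ∩ C).filter fun c => a ∈ F c).card : ℂ))) = 0 := by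
    intro J hJ
    obtain ⟨k, hk⟩ := hcols J hJ
    have h1 : ∑ i, β i * ∏ a ∈ u i, (tx p₀ none a + ∑ q ∈ cols k, tx p₀ (some q) a) = 0 := by
      have := congrFun hβM k
      exact this
    rw [← hk, Finset.sum_congr rfl fun S _ => by rw [← htx (cols k) S], ← h1]
    have h2 : ∀ S : Finset (Fin h), b S * ∏ a ∈ S, (tx p₀ none a + ∑ q ∈ cols k, tx p₀ (some q) a)
        = ∑ i ∈ Finset.univ.filter (fun i => u i = S),
            β i * ∏ a ∈ u i, (tx p₀ none a + ∑ q ∈ cols k, tx p₀ (some q) a) := by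
      intro S
      simp only [b, Finset.sum_mul]
      refine Finset.sum_congr rfl fun i hi => ?_
      rw [(Finset.mem_filter.mp hi).2]
    rw [Finset.sum_congr rfl fun S _ => h2 S, Finset.sum_fiberwise]
  have hzero := rowKernel_zero h C N hN 𝔈 h𝔈N h𝔈2 hclosed F hF𝔈 hFinj b hb_univ hb_erase hb_E hcol
  apply hβ
  funext i
  rw [Pi.zero_apply, ← hbu i]
  exact hzero (u i)

/-- **The size of the ball**: `#{J ⊆ Fin h : |J| + 2 ≤ h} + (h + 1) = 2^h`. -/
theorem card_ball (h : ℕ) :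
    (Finset.univ.filter fun J : Finset (Fin h) => J.card + 2 ≤ h).card + (h + 1) = 2 ^ h := by
  classical
  have h1 := Finset.card_filter_add_card_filter_not (s := (Finset.univ : Finset (Finset (Fin h))))
    (fun J : Finset (Fin h) => J.card + 2 ≤ h)
  have h2 : (Finset.univ.filter fun J : Finset (Fin h) => ¬ J.card + 2 ≤ h).card = h + 1 := by
    have hset : (Finset.univ.filter fun J : Finset (Fin h) => ¬ J.card + 2 ≤ h)
        = insert Finset.univ (Finset.univ.image fun q : Fin h => Finset.univ.erase q) := by
      ext J
      simp only [Finset.mem_filter, Finset.mem_univ, true_and, Finset.mem_insert, Finset.mem_image]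
      constructor
      · intro hJ
        have hJ' : ¬ J.card + 2 ≤ (Finset.univ : Finset (Fin h)).card := by
          rwa [Finset.card_univ, Fintype.card_fin]
        rcases eq_or_eq_erase_of_cocard_lt_two Finset.univ J (Finset.subset_univ J) hJ' with h' | ⟨q, -, h'⟩
        · exact Or.inl h'
        · exact Or.inr ⟨q, h'.symm⟩
      · rintro (rfl | ⟨q, rfl⟩)
        · rw [Finset.card_univ, Fintype.card_fin]; omega
        · rw [Finset.card_erase_of_mem (Finset.mem_univ q), Finset.card_univ, Fintype.card_fin]; omega
    rw [hset, Finset.card_insert_of_notMem, Finset.card_image_of_injective _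
      (fun q q' hqq => Finset.erase_injOn _ (Finset.mem_univ q) (Finset.mem_univ q') hqq),
      Finset.card_univ, Fintype.card_fin]
    intro hmem
    obtain ⟨q, -, hq⟩ := Finset.mem_image.mp hmem
    have := Finset.notMem_erase q Finset.univ
    rw [hq] at this
    exact this (Finset.mem_univ q)
  rw [h2, Finset.card_univ, Fintype.card_finset, Fintype.card_fin] at h1
  exact h1

/-- **THE BALL CELL**: the body of the lower node at `(h, 2^h − (h + 1))` for every `h ≥ 1`, by ONE piece on `h` states whose
columns are the ball `B_{h−2}` (unit weights). -/
theorem ballCell (h : ℕ) (h1 : 1 ≤ h) :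
    ∃ (m K : ℕ) (W : Fin m → ℕ) (wt : Fin m → Fin K → ℕ) (e : Fin (2 ^ h - (h + 1)) → Fin m × Finset (Fin K)),
      m ≤ h + h ∧ K ≤ h * h * h ∧ Function.Injective e ∧
      (∀ x : Fin m × Finset (Fin K), x ∉ Set.range e →
        ∀ i, W (e i).1 + ∑ k ∈ (e i).2, wt (e i).1 k < W x.1 + ∑ k ∈ x.2, wt x.1 k) ∧
      ∀ u : Fin (2 ^ h - (h + 1)) → Finset (Fin h), Function.Injective u → IsLowerSet (Set.range u) →
        ∃ tx : Fin m → Option (Fin K) → Fin h → ℂ,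
          (Matrix.of fun i k : Fin (2 ^ h - (h + 1)) =>
            ∏ a ∈ u i, (tx (e k).1 none a + ∑ q ∈ (e k).2, tx (e k).1 (some q) a)).det ≠ 0 := by
  classical
  set B : Finset (Finset (Fin h)) := Finset.univ.filter fun J : Finset (Fin h) => J.card + 2 ≤ h with hB
  have hBc : B.card = 2 ^ h - (h + 1) := by
    have := card_ball h
    rw [← hB] at this
    omega
  let σ : ↥B ≃ Fin (2 ^ h - (h + 1)) := Finset.equivFinOfCardEq hBc
  let ball : Fin (2 ^ h - (h + 1)) → Finset (Fin h) := fun k => (σ.symm k).1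
  have hballB : ∀ k, (ball k).card + 2 ≤ h := fun k => (Finset.mem_filter.mp (σ.symm k).2).2
  have hball_inj : Function.Injective ball := fun k k' hkk => σ.symm.injective (Subtype.ext hkk)
  have hball_surj : ∀ J : Finset (Fin h), J.card + 2 ≤ h → ∃ k, ball k = J := fun J hJ =>
    ⟨σ ⟨J, Finset.mem_filter.mpr ⟨Finset.mem_univ _, hJ⟩⟩, by simp [ball]⟩
  let e : Fin (2 ^ h - (h + 1)) → Fin 1 × Finset (Fin h) := fun k => (0, ball k)
  refine ⟨1, h, fun _ => 0, fun _ _ => 1, e, by omega, ?_, ?_, ?_, ?_⟩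
  · calc h = h * 1 * 1 := by ring
      _ ≤ h * h * h := by gcongr
  · intro k k' hkk
    exact hball_inj (Prod.ext_iff.mp hkk).2
  · rintro ⟨p, J'⟩ hx i
    have hp : p = 0 := Fin.fin_one_eq_zero p
    subst hp
    have hJ' : ¬ J'.card + 2 ≤ h := by
      intro hJ'
      obtain ⟨k, hk⟩ := hball_surj J' hJ'
      exact hx ⟨k, by simp [e, hk]⟩
    have hi := hballB i
    simp only [e, zero_add, Finset.sum_const, smul_eq_mul, mul_one]
    omega
  · intro u hu hlow
    have hr : (2 ^ h - (h + 1)) + (h + 1) = 2 ^ h := Nat.sub_add_cancel (Nat.succ_le_of_lt Nat.lt_two_pow_self)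
    exact ball_good h _ 1 0 u hu hlow hr ball hball_surj

/-- **EVERY DIAGONAL CELL** `D_c = (c − 1, 2^{c−1} − c)`, `c ≥ 2` — the hypothesis of `CoreLift.universalJoinWideLower_of_diagonal`
(p629886), in exactly its shape. -/
theorem diagonalCell (c : ℕ) (h2 : 2 ≤ c) :
    ∃ (m K : ℕ) (W : Fin m → ℕ) (wt : Fin m → Fin K → ℕ) (e : Fin (2 ^ (c - 1) - c) → Fin m × Finset (Fin K)),
      m ≤ (c - 1) + (c - 1) ∧ K ≤ (c - 1) * (c - 1) * (c - 1) ∧ Function.Injective e ∧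
      (∀ x : Fin m × Finset (Fin K), x ∉ Set.range e →
        ∀ i, W (e i).1 + ∑ k ∈ (e i).2, wt (e i).1 k < W x.1 + ∑ k ∈ x.2, wt x.1 k) ∧
      ∀ u : Fin (2 ^ (c - 1) - c) → Finset (Fin (c - 1)), Function.Injective u → IsLowerSet (Set.range u) →
        ∃ tx : Fin m → Option (Fin K) → Fin (c - 1) → ℂ,
          (Matrix.of fun i k : Fin (2 ^ (c - 1) - c) =>
            ∏ a ∈ u i, (tx (e k).1 none a + ∑ q ∈ (e k).2, tx (e k).1 (some q) a)).det ≠ 0 := by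
  have hc : c - 1 + 1 = c := by omega
  have key := ballCell (c - 1) (by omega)
  rw [hc] at key
  exact key

/-- **THE LINEAR WINDOW.** The body of the lower node at `(h, 2^h − c)` for every `h` and every `2 ≤ c ≤ h + 1`. -/
theorem universalJoinWideLower_linearWindow (h c : ℕ) (h2 : 2 ≤ c) (hch : c ≤ h + 1) :
    ∃ (m K : ℕ) (W : Fin m → ℕ) (wt : Fin m → Fin K → ℕ) (e : Fin (2 ^ h - c) → Fin m × Finset (Fin K)),
      m ≤ h + h ∧ K ≤ h * h * h ∧ Function.Injective e ∧
      (∀ x : Fin m × Finset (Fin K), x ∉ Set.range e →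
        ∀ i, W (e i).1 + ∑ k ∈ (e i).2, wt (e i).1 k < W x.1 + ∑ k ∈ x.2, wt x.1 k) ∧
      ∀ u : Fin (2 ^ h - c) → Finset (Fin h), Function.Injective u → IsLowerSet (Set.range u) →
        ∃ tx : Fin m → Option (Fin K) → Fin h → ℂ,
          (Matrix.of fun i k : Fin (2 ^ h - c) =>
            ∏ a ∈ u i, (tx (e k).1 none a + ∑ q ∈ (e k).2, tx (e k).1 (some q) a)).det ≠ 0 :=
  CoreLift.universalJoinWideLower_of_diagonal (h + 1) (fun c' h2' _ => diagonalCell c' h2') h c h2 hch hch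

/-- **THE TOP WINDOW, ALL `h`**: the body of the lower node at `(h, 2^h − c)` for every `h ≥ 1` and every `c ≤ h + 1`
(`h ≤ 18`: all sizes, `HubWide.universalJoinWide_upto_eighteen`; `c ≤ 1`: `CoreLift.universalJoinWideLower_coTop_nineteen`;
`2 ≤ c ≤ h + 1`: the linear window). -/
theorem universalJoinWideLower_topWindow (h c : ℕ) (h1 : 1 ≤ h) (hc : c ≤ h + 1) :
    ∃ (m K : ℕ) (W : Fin m → ℕ) (wt : Fin m → Fin K → ℕ) (e : Fin (2 ^ h - c) → Fin m × Finset (Fin K)),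
      m ≤ h + h ∧ K ≤ h * h * h ∧ Function.Injective e ∧
      (∀ x : Fin m × Finset (Fin K), x ∉ Set.range e →
        ∀ i, W (e i).1 + ∑ k ∈ (e i).2, wt (e i).1 k < W x.1 + ∑ k ∈ x.2, wt x.1 k) ∧
      ∀ u : Fin (2 ^ h - c) → Finset (Fin h), Function.Injective u → IsLowerSet (Set.range u) →
        ∃ tx : Fin m → Option (Fin K) → Fin h → ℂ,
          (Matrix.of fun i k : Fin (2 ^ h - c) =>
            ∏ a ∈ u i, (tx (e k).1 none a + ∑ q ∈ (e k).2, tx (e k).1 (some q) a)).det ≠ 0 := by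
  by_cases h18 : h ≤ 18
  · obtain ⟨m, K, W, wt, e, hm, hK, he, hthr, hgood⟩ :=
      HubWide.universalJoinWide_upto_eighteen h h1 h18 (2 ^ h - c) (Nat.sub_le _ _)
    exact ⟨m, K, W, wt, e, hm, hK, he, hthr, fun u hu _ => hgood u hu⟩
  · by_cases hc2 : 2 ≤ c
    · exact universalJoinWideLower_linearWindow h c hc2 hc
    · exact CoreLift.universalJoinWideLower_coTop_nineteen h c (by omega) (by omega)

/-- At `h = 19` the linear window adds the cell `r = 2^19 − 20 = 524 268`; the open lower window there is now
`517 159 ≤ r ≤ 524 267` (`2^19 − 2^12 − 1129 = 517 159`, p626621). -/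
theorem window_nineteen : 2 ^ 19 - 20 = 524268 ∧ 2 ^ 19 - 21 = 524267 := by norm_num

end BallDiag

end

end Summit.ValiantsHypothesis.ValiantsHypothesis.Theorems.BarrierLever.HiddenStates
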